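import Literature.AlgebraicGeometry.RelativeSpec.EquivariantModuleRankDescent
import Literature.AlgebraicGeometry.Modules.EquivariantStructure
import Literature.AlgebraicGeometry.KTheory.EulerCharacteristic
import HarnessLib

/-!
# Galois descent of COMPLEXES of quasi-coherent modules along a free finite quotient: the descended
# module is functorial in equivariant morphisms, so an equivariant complex descends term by term

Sequel to `RelativeSpec/EquivariantModuleInvariants` (the module of invariants `(p_* E)^G =
ρ.moduleInvariants E φ` of a `G`-equivariant module `(E, φ)` along `p : X ⟶ Q`, and the comparison
`descentHom : p^* (p_* E)^G ⟶ E`), `RelativeSpec/EquivariantModuleDescent` ((T1): `descentHom` is an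
isomorphism for an affine geometric quotient by a FREE finite action and `E` quasi-coherent) and
`RelativeSpec/EquivariantModuleRankDescent` ((β): rank descends). Those files descend ONE module; here:

* §1 **functoriality in equivariant morphisms** (no finiteness or freeness needed): for
  `f : E₁ ⟶ E₂` intertwining the structures (`(ρ.aut g)^* f ≫ φ₂ g = φ₁ g ≫ f`), the action on the
  direct images commutes with `p_* f` (`pushforwardAct_comp_map`), hence `p_* f` restricts to
  **`moduleInvariantsMap : (p_* E₁)^G ⟶ (p_* E₂)^G`** (`kernel.map`; `moduleInvariantsMap_ι`,
  `_id`, `_comp`, `_zero`), and the comparison is NATURAL: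
  **`pullback_map_moduleInvariantsMap_comp_descentHom : p^*(f^G) ≫ descentHom₂ = descentHom₁ ≫ f`**;
* §2 **equivariant complexes** (`EquivariantComplexStructure ρ K`: a `G`-linearisation
  `Modules/EquivariantStructure.EquivariantStructure` of every term of a homological complex `K` of
  `𝒪_X`-modules, commuting with the differentials — DATA `term` + the `Prop` `d_comm`; no instance;
  the canonical one `ofPullback` on `p^* L`), the **descended complex**
  **`descendComplex ρ K Φ`** (terms `(p_* Kⁱ)^G`, differentials `moduleInvariantsMap (K.d i j)`) and the
  chain map **`descentHomComplex : p^*(descendComplex) ⟶ K`** (termwise `descentHom`), which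
  intertwines the canonical linearisation of the pull-back with `Φ` (`pullback_map_descentHomComplex_f_comp`)
  and is an ISOMORPHISM OF COMPLEXES for an affine geometric quotient by a free finite action and
  termwise quasi-coherent `K` (**`isIso_descentHomComplex`**, **`pullbackDescendComplexIso`** — (T1)
  termwise; `HomologicalComplex.Hom.isIso_of_components`);
* §3 what descends with it: quasi-coherence (`isQuasicoherent_moduleInvariants`), vanishing
  (`isZero_moduleInvariants`), FINITE LOCAL FREENESS of non-constant rank
  (**`isFiniteLocallyFree_moduleInvariants_of_free`**: on an affine `V ∋ q` the sections of a vector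
  bundle over the affine `p⁻¹V` are finite projective (Görtz–Wedhorn I Cor. 7.42), so are those of the
  invariants (`finite_projective_sections_moduleInvariants`, Chase–Harrison–Rosenberg), hence a frame
  on a basic open `D(s) ∋ q` — the proof of (β) `hasRank_moduleInvariants_of_free` without the rank
  count), so a BOUNDED COMPLEX OF VECTOR BUNDLES descends to one
  (**`isBoundedVBComplex_descendComplex`**).

This is [MumfordAV1970] §12 Thm. 1 / [MumfordFogartyKirwan1994] Prop. 7.1 («`p^*` is an equivalence
between quasi-coherent modules on `X/G` and `G`-equivariant quasi-coherent modules on `X`») read on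
MORPHISMS — the inverse equivalence `(E, φ) ↦ (p_* E)^G` is a functor and `descentHom` a natural
isomorphism — and applied degreewise to complexes (SGA 1 VIII 1.1: descent of quasi-coherent modules
AND their morphisms along `p`). Everything is proved; no named facts; the `def`s are constructions with
bodies; no instance, no notation.

## References

* [MumfordAV1970] D. Mumford, *Abelian Varieties* (1970), §7 Thm. p. 66 and §12 Thm. 1 (p. 112).
* [MumfordFogartyKirwan1994] D. Mumford, J. Fogarty, F. Kirwan, *Geometric Invariant Theory*, 3rd ed.
  (1994), Ch. 1 §3 Def. 1.6 (p. 30), Prop. 7.1.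
* [Greither1992CyclicGalois] C. Greither, LNM 1534 (1992), Ch. 0 Thm. 7.1, Prop. 7.2 (pp. 28–29).
* [SGA1] A. Grothendieck, M. Raynaud, SGA 1, Exp. VIII Thm. 1.1, Prop. 1.10.
* [GortzWedhorn2020] U. Görtz, T. Wedhorn, *Algebraic Geometry I*, 2nd ed., Cor. 7.42.
-/

noncomputable section

-- `TopCat.Presheaf`/`Scheme.Modules` are not reducible (as in Mathlib's `AlgebraicGeometry/Modules`).
set_option backward.isDefEq.respectTransparency false

universe u

open CategoryTheory Limits AlgebraicGeometry TopologicalSpace Opposite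
open Literature.AlgebraicGeometry.Modules Literature.AlgebraicGeometry.Motives
open Literature.AlgebraicGeometry.KTheory

namespace Literature.AlgebraicGeometry.RelativeSpec.ActionOver

variable {X Q : Scheme.{u}} {p : X ⟶ Q} {G : Type u} [Group G] (ρ : ActionOver p G)

/-! ### §1 Functoriality of `(p_* E)^G` and of `descentHom` in equivariant morphisms -/

section Functorial

variable {E₁ E₂ E₃ : X.Modules}
  (φ₁ : ∀ g : G, (Scheme.Modules.pullback (ρ.aut g).hom).obj E₁ ≅ E₁)
  (φ₂ : ∀ g : G, (Scheme.Modules.pullback (ρ.aut g).hom).obj E₂ ≅ E₂)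
  (φ₃ : ∀ g : G, (Scheme.Modules.pullback (ρ.aut g).hom).obj E₃ ≅ E₃)
  (f : E₁ ⟶ E₂)
  (hf : ∀ g : G, (Scheme.Modules.pullback (ρ.aut g).hom).map f ≫ (φ₂ g).hom = (φ₁ g).hom ≫ f)

/-- The composite of two equivariant morphisms is equivariant. [cite: MumfordFogartyKirwan1994, Ch. 1 §3 Def. 1.6 (p. 30)] -/
theorem equivariant_comp {f : E₁ ⟶ E₂} {f' : E₂ ⟶ E₃}
    (hf : ∀ g : G, (Scheme.Modules.pullback (ρ.aut g).hom).map f ≫ (φ₂ g).hom = (φ₁ g).hom ≫ f)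
    (hf' : ∀ g : G, (Scheme.Modules.pullback (ρ.aut g).hom).map f' ≫ (φ₃ g).hom = (φ₂ g).hom ≫ f')
    (g : G) :
    (Scheme.Modules.pullback (ρ.aut g).hom).map (f ≫ f') ≫ (φ₃ g).hom = (φ₁ g).hom ≫ f ≫ f' := by
  rw [Functor.map_comp, Category.assoc, hf' g, reassoc_of% (hf g)]

/-- The zero morphism is equivariant. [cite: MumfordFogartyKirwan1994, Ch. 1 §3 Def. 1.6 (p. 30)] -/
theorem equivariant_zero (g : G) :
    (Scheme.Modules.pullback (ρ.aut g).hom).map (0 : E₁ ⟶ E₂) ≫ (φ₂ g).hom = (φ₁ g).hom ≫ 0 := by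
  rw [Functor.map_zero, zero_comp, comp_zero]

/-- The identity is equivariant. [cite: MumfordFogartyKirwan1994, Ch. 1 §3 Def. 1.6 (p. 30)] -/
theorem equivariant_id (g : G) :
    (Scheme.Modules.pullback (ρ.aut g).hom).map (𝟙 E₁) ≫ (φ₁ g).hom = (φ₁ g).hom ≫ 𝟙 E₁ := by
  rw [CategoryTheory.Functor.map_id, Category.id_comp, Category.comp_id]

include hf in
/-- The adjuncts `θ_g : Eᵢ ⟶ (ρ.aut g)_* Eᵢ` of the structures commute with an equivariant `f`:
`θ_g ≫ (ρ.aut g)_* f = f ≫ θ_g`. [cite: MumfordFogartyKirwan1994, Ch. 1 §3 Def. 1.6 (p. 30)] -/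
theorem twistHom_comp_map (g : G) :
    ρ.twistHom E₁ φ₁ g ≫ (Scheme.Modules.pushforward (ρ.aut g).hom).map f = f ≫ ρ.twistHom E₂ φ₂ g := by
  have hu := (Scheme.Modules.pullbackPushforwardAdjunction (ρ.aut g).hom).unit.naturality f
  simp only [Functor.id_map, Functor.comp_map] at hu
  simp only [twistHom, Category.assoc]
  rw [← Functor.map_comp, ← hf g, Functor.map_comp, ← reassoc_of% hu]

include hf in
/-- **The action on the direct images commutes with `p_* f`** for an equivariant `f`:
`(g · –) ≫ p_* f = p_* f ≫ (g · –)`. [cite: MumfordFogartyKirwan1994, Ch. 1 §3 Def. 1.6 (p. 30)] -/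
theorem pushforwardAct_comp_map (g : G) :
    ρ.pushforwardAct E₁ φ₁ g ≫ (Scheme.Modules.pushforward p).map f =
      (Scheme.Modules.pushforward p).map f ≫ ρ.pushforwardAct E₂ φ₂ g := by
  have h1 := (Scheme.Modules.pushforwardCongr (ρ.aut_comp g)).hom.naturality f
  have h2 := (Scheme.Modules.pushforwardComp (ρ.aut g).hom p).hom.naturality f
  simp only [Functor.comp_map] at h2
  simp only [pushforwardAct, Category.assoc]
  rw [← h1, ← reassoc_of% h2, ← Functor.map_comp_assoc, ρ.twistHom_comp_map φ₁ φ₂ f hf g,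
    Functor.map_comp_assoc]

variable [Fintype G]

include hf in
/-- The defect maps `s ↦ (g · s - s)_g` commute with `p_* f` for an equivariant `f`. [cite: MumfordAV1970, §7 Thm. p. 66 (2)] -/
theorem invariantsDefect_comp_map :
    ρ.invariantsDefect E₁ φ₁ ≫ Limits.Pi.map (fun _ : G => (Scheme.Modules.pushforward p).map f) =
      (Scheme.Modules.pushforward p).map f ≫ ρ.invariantsDefect E₂ φ₂ := by
  refine Limits.Pi.hom_ext _ _ fun g => ?_
  simp only [invariantsDefect, Category.assoc, Limits.Pi.map_π, Limits.Pi.lift_π_assoc, Limits.Pi.lift_π,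
    Preadditive.sub_comp, Preadditive.comp_sub, Category.id_comp, Category.comp_id,
    ρ.pushforwardAct_comp_map φ₁ φ₂ f hf g]

/-- **`(p_* –)^G` on an equivariant morphism**: the restriction `(p_* E₁)^G ⟶ (p_* E₂)^G` of `p_* f` to
the invariants (the inverse-image equivalence of [MFK94] Prop. 7.1 read on morphisms).
[cite: MumfordFogartyKirwan1994, Ch. 1 §3 Prop. 7.1] [cite: MumfordAV1970, §12 Thm. 1 (p. 112)] -/
def moduleInvariantsMap : ρ.moduleInvariants E₁ φ₁ ⟶ ρ.moduleInvariants E₂ φ₂ :=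
  kernel.map (ρ.invariantsDefect E₁ φ₁) (ρ.invariantsDefect E₂ φ₂) ((Scheme.Modules.pushforward p).map f)
    (Limits.Pi.map fun _ : G => (Scheme.Modules.pushforward p).map f) (ρ.invariantsDefect_comp_map φ₁ φ₂ f hf)

/-- `moduleInvariantsMap` is `p_* f` on the invariants: `f^G ≫ ι₂ = ι₁ ≫ p_* f`. [cite: MumfordAV1970, §12 Thm. 1 (p. 112)] -/
@[reassoc (attr := simp)]
theorem moduleInvariantsMap_ι :
    ρ.moduleInvariantsMap φ₁ φ₂ f hf ≫ ρ.moduleInvariantsι E₂ φ₂ =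
      ρ.moduleInvariantsι E₁ φ₁ ≫ (Scheme.Modules.pushforward p).map f :=
  kernel.lift_ι _ _ _

/-- `(𝟙)^G = 𝟙` (functoriality of `(p_* –)^G`, [MFK94] Prop. 7.1 on morphisms). [cite: MumfordFogartyKirwan1994, Ch. 1 §3 Prop. 7.1] -/
theorem moduleInvariantsMap_id :
    ρ.moduleInvariantsMap φ₁ φ₁ (𝟙 E₁) (ρ.equivariant_id φ₁) = 𝟙 _ := by
  haveI := ρ.mono_moduleInvariantsι E₁ φ₁
  rw [← cancel_mono (ρ.moduleInvariantsι E₁ φ₁), moduleInvariantsMap_ι, CategoryTheory.Functor.map_id,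
    Category.comp_id, Category.id_comp]

/-- `(f ≫ f')^G = f^G ≫ f'^G` (functoriality of `(p_* –)^G`, [MFK94] Prop. 7.1 on morphisms). [cite: MumfordFogartyKirwan1994, Ch. 1 §3 Prop. 7.1] -/
theorem moduleInvariantsMap_comp {f : E₁ ⟶ E₂} {f' : E₂ ⟶ E₃}
    (hf : ∀ g : G, (Scheme.Modules.pullback (ρ.aut g).hom).map f ≫ (φ₂ g).hom = (φ₁ g).hom ≫ f)
    (hf' : ∀ g : G, (Scheme.Modules.pullback (ρ.aut g).hom).map f' ≫ (φ₃ g).hom = (φ₂ g).hom ≫ f') :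
    ρ.moduleInvariantsMap φ₁ φ₂ f hf ≫ ρ.moduleInvariantsMap φ₂ φ₃ f' hf' =
      ρ.moduleInvariantsMap φ₁ φ₃ (f ≫ f') (ρ.equivariant_comp φ₁ φ₂ φ₃ hf hf') := by
  haveI := ρ.mono_moduleInvariantsι E₃ φ₃
  rw [← cancel_mono (ρ.moduleInvariantsι E₃ φ₃), Category.assoc, moduleInvariantsMap_ι,
    moduleInvariantsMap_ι_assoc, moduleInvariantsMap_ι, Functor.map_comp]

/-- `0^G = 0` (for any proof that the zero morphism is equivariant, e.g. a differential off the shape; additivity of `(p_* –)^G`). [cite: MumfordFogartyKirwan1994, Ch. 1 §3 Prop. 7.1] -/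
theorem moduleInvariantsMap_zero {f : E₁ ⟶ E₂}
    (hf : ∀ g : G, (Scheme.Modules.pullback (ρ.aut g).hom).map f ≫ (φ₂ g).hom = (φ₁ g).hom ≫ f) (h0 : f = 0) :
    ρ.moduleInvariantsMap φ₁ φ₂ f hf = 0 := by
  haveI := ρ.mono_moduleInvariantsι E₂ φ₂
  rw [← cancel_mono (ρ.moduleInvariantsι E₂ φ₂), moduleInvariantsMap_ι, h0, Functor.map_zero, comp_zero,
    zero_comp]

/-- **Naturality of the comparison `p^*(p_* E)^G ⟶ E`**: for an equivariant `f`,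
`p^*(f^G) ≫ descentHom₂ = descentHom₁ ≫ f` (both are adjuncts of `ι₁ ≫ p_* f = f^G ≫ ι₂`).
[cite: Greither1992CyclicGalois, Ch. 0 Prop. 7.2 (p. 29)] [cite: MumfordAV1970, §12 Thm. 1 (p. 112)] -/
@[reassoc]
theorem pullback_map_moduleInvariantsMap_comp_descentHom :
    (Scheme.Modules.pullback p).map (ρ.moduleInvariantsMap φ₁ φ₂ f hf) ≫ ρ.descentHom E₂ φ₂ =
      ρ.descentHom E₁ φ₁ ≫ f := by
  rw [descentHom, descentHom, ← Adjunction.homEquiv_naturality_left_symm,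
    ← Adjunction.homEquiv_naturality_right_symm, moduleInvariantsMap_ι]

end Functorial

/-! ### §2 Equivariant complexes and the descended complex -/

section Complex

variable {κ : Type*} {c : ComplexShape κ}

/-- **A `G`-equivariant structure on a homological complex `K` of `𝒪_X`-modules** for the action
`ρ` over `p : X ⟶ Q`: a `G`-linearisation `term i : ρ.EquivariantStructure (K.X i)` of every term
(isomorphisms `σ_g^* Kⁱ ≅ Kⁱ` with unit and cocycle conditions, `Modules/EquivariantStructure`) such
that the differentials are equivariant (`d_comm`). Equivalently: isomorphisms of complexes
`σ_g^*• K ≅ K` with unit and cocycle conditions ([MFK94] Ch. 1 §3 Def. 1.6 in the abelian category of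
complexes); the termwise form is the one the descent theorems consume. DATA `term`; `d_comm` is a `Prop`;
no instance. [cite: MumfordFogartyKirwan1994, Ch. 1 §3 Def. 1.6 (p. 30)] [cite: MumfordAV1970, §12 Thm. 1 (p. 112)] -/
structure EquivariantComplexStructure (K : HomologicalComplex X.Modules c) where
  /-- the `G`-linearisation of the `i`-th term -/
  term : ∀ i, ρ.EquivariantStructure (K.X i)
  /-- the differentials are equivariant: `σ_g^*(d) ≫ φ_g = φ_g ≫ d` -/
  d_comm : ∀ (g : G) (i j : κ),
    (Scheme.Modules.pullback (ρ.aut g).hom).map (K.d i j) ≫ ((term j).iso g).hom = ((term i).iso g).hom ≫ K.d i j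

namespace EquivariantComplexStructure

variable {ρ}

/-- Unfolding the canonical linearisation of a pulled-back module on morphisms:
`(ofPullback ρ F).iso g = (σ_g^* p^* F ≅ (σ_g ≫ p)^* F) ≫ ((σ_g ≫ p)^* F = p^* F)`. [cite: MumfordAV1970, §7 (Prop. 2)] -/
theorem ofPullback_iso_hom (F : Q.Modules) (g : G) :
    ((EquivariantStructure.ofPullback ρ F).iso g).hom =
      (Scheme.Modules.pullbackComp (ρ.autHom g) p).hom.app F ≫ (Scheme.Modules.pullbackCongr (ρ.autHom_comp g)).hom.app F :=
  rfl

/-- **The canonical equivariant structure of a pulled-back complex** `p^*• L`, `L` a complex on `Q`: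
termwise `EquivariantStructure.ofPullback`; the differentials `p^* d` are equivariant by naturality of
`σ_g^* p^* ≅ (σ_g ≫ p)^* = p^*`. [cite: MumfordAV1970, §7 (Prop. 2)] -/
def ofPullback (L : HomologicalComplex Q.Modules c) :
    ρ.EquivariantComplexStructure (((Scheme.Modules.pullback p).mapHomologicalComplex c).obj L) where
  term i := EquivariantStructure.ofPullback ρ (L.X i)
  d_comm g i j := by
    have h1 := (Scheme.Modules.pullbackComp (ρ.autHom g) p).hom.naturality (L.d i j)
    have h2 := (Scheme.Modules.pullbackCongr (ρ.autHom_comp g)).hom.naturality (L.d i j)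
    simp only [Functor.comp_map] at h1
    simp only [Functor.mapHomologicalComplex_obj_d, ofPullback_iso_hom, Category.assoc]
    rw [← h2, ← reassoc_of% h1]

end EquivariantComplexStructure

variable [Fintype G] (K : HomologicalComplex X.Modules c) (Φ : ρ.EquivariantComplexStructure K)

/-- **The descended complex `(p_*• K)^G` on `Q`** of an equivariant complex `(K, Φ)` on `X`: terms the
modules of invariants `(p_* Kⁱ)^G` (`moduleInvariants`), differentials the restrictions of `p_* d`
(`moduleInvariantsMap`, §1). For an affine geometric quotient by a free finite action and termwise
quasi-coherent `K` this is THE complex on `Q` pulling back to `K` (`pullbackDescendComplexIso`).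
[cite: MumfordAV1970, §12 Thm. 1 (p. 112)] [cite: SGA1, Exp. VIII Thm. 1.1] -/
def descendComplex : HomologicalComplex Q.Modules c where
  X i := ρ.moduleInvariants (K.X i) (Φ.term i).iso
  d i j := ρ.moduleInvariantsMap (Φ.term i).iso (Φ.term j).iso (K.d i j) (fun g => Φ.d_comm g i j)
  shape i j hij := ρ.moduleInvariantsMap_zero _ _ _ (K.shape i j hij)
  d_comp_d' i j k _ _ := by
    rw [ρ.moduleInvariantsMap_comp (Φ.term i).iso (Φ.term j).iso (Φ.term k).iso]
    exact ρ.moduleInvariantsMap_zero _ _ _ (K.d_comp_d i j k)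

/-- The terms of the descended complex (definitional). [cite: MumfordAV1970, §12 Thm. 1 (p. 112)] -/
theorem descendComplex_X (i : κ) : (ρ.descendComplex K Φ).X i = ρ.moduleInvariants (K.X i) (Φ.term i).iso := rfl

/-- The differentials of the descended complex (definitional). [cite: MumfordAV1970, §12 Thm. 1 (p. 112)] -/
theorem descendComplex_d (i j : κ) :
    (ρ.descendComplex K Φ).d i j =
      ρ.moduleInvariantsMap (Φ.term i).iso (Φ.term j).iso (K.d i j) (fun g => Φ.d_comm g i j) := rfl

/-- The inclusion `(p_*• K)^G ⟶ p_*• K` as a chain map (termwise `moduleInvariantsι`). [cite: MumfordAV1970, §7 Thm. p. 66 (2)] -/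
def descendComplexι : ρ.descendComplex K Φ ⟶ ((Scheme.Modules.pushforward p).mapHomologicalComplex c).obj K where
  f i := ρ.moduleInvariantsι (K.X i) (Φ.term i).iso
  comm' i j _ := by
    simp only [Functor.mapHomologicalComplex_obj_d, descendComplex_d, moduleInvariantsMap_ι]

/-- **The comparison chain map `p^*• (p_*• K)^G ⟶ K`** (termwise `descentHom`; a chain map by the
naturality `pullback_map_moduleInvariantsMap_comp_descentHom`). [cite: MumfordAV1970, §12 Thm. 1 (p. 112)] -/
def descentHomComplex : ((Scheme.Modules.pullback p).mapHomologicalComplex c).obj (ρ.descendComplex K Φ) ⟶ K where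
  f i := ρ.descentHom (K.X i) (Φ.term i).iso
  comm' i j _ := by
    simp only [Functor.mapHomologicalComplex_obj_d, descendComplex_d]
    exact (ρ.pullback_map_moduleInvariantsMap_comp_descentHom _ _ _ _).symm

/-- The components of `descentHomComplex` (definitional). [cite: MumfordAV1970, §12 Thm. 1 (p. 112)] -/
@[simp]
theorem descentHomComplex_f (i : κ) : (ρ.descentHomComplex K Φ).f i = ρ.descentHom (K.X i) (Φ.term i).iso := rfl

/-- **`descentHomComplex` intertwines the canonical equivariant structure of the pull-back with `Φ`**
(termwise `pullback_map_descentHom_comp`). [cite: MumfordAV1970, §12 Thm. 1 (p. 112)] -/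
theorem pullback_map_descentHomComplex_f_comp (g : G) (i : κ) :
    (Scheme.Modules.pullback (ρ.aut g).hom).map ((ρ.descentHomComplex K Φ).f i) ≫ ((Φ.term i).iso g).hom =
      (((EquivariantComplexStructure.ofPullback (ρ.descendComplex K Φ)).term i).iso g).hom ≫
        (ρ.descentHomComplex K Φ).f i :=
  ρ.pullback_map_descentHom_comp (K.X i) (Φ.term i).iso g

/-- **(T1) for complexes: `p^*• (p_*• K)^G ⟶ K` is an isomorphism of complexes** for an affine geometric
quotient `p : X ⟶ Q` by a finite group acting freely on the affine charts and a termwise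
quasi-coherent equivariant complex `(K, Φ)` — termwise the Chase–Harrison–Rosenberg descent
isomorphism `isIso_descentHom`, with the unit and cocycle conditions supplied by the fields of
`EquivariantStructure`. [cite: MumfordAV1970, §12 Thm. 1 (p. 112)] [cite: Greither1992CyclicGalois, Ch. 0 Thm. 7.1 (pp. 28–29)] -/
theorem isIso_descentHomComplex [IsAffineHom p] (hq : ρ.IsGeometricQuotient p)
    (hfree : ∀ (V : Q.Opens), IsAffineOpen V → ∀ g : G, g ≠ 1 →
      Ideal.span (Set.range fun b : Γ(X, p ⁻¹ᵁ V) ↦ ρ.act g V b - b) = ⊤)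
    [∀ i, (K.X i).IsQuasicoherent] : IsIso (ρ.descentHomComplex K Φ) := by
  haveI : ∀ i, IsIso ((ρ.descentHomComplex K Φ).f i) := fun i =>
    ρ.isIso_descentHom (K.X i) (Φ.term i).iso hq hfree (IsAffineLocalizing.of_isQuasicoherent _)
      (Φ.term i).iso_one_hom (Φ.term i).iso_mul_hom
  exact HomologicalComplex.Hom.isIso_of_components _

/-- **The descended complex pulls back to the given one: `p^*• (descendComplex K Φ) ≅ K`**, as
complexes (`asIso descentHomComplex`; hence a quasi-isomorphism). [cite: MumfordAV1970, §12 Thm. 1 (p. 112)] -/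
def pullbackDescendComplexIso [IsAffineHom p] (hq : ρ.IsGeometricQuotient p)
    (hfree : ∀ (V : Q.Opens), IsAffineOpen V → ∀ g : G, g ≠ 1 →
      Ideal.span (Set.range fun b : Γ(X, p ⁻¹ᵁ V) ↦ ρ.act g V b - b) = ⊤)
    [∀ i, (K.X i).IsQuasicoherent] :
    ((Scheme.Modules.pullback p).mapHomologicalComplex c).obj (ρ.descendComplex K Φ) ≅ K :=
  haveI := ρ.isIso_descentHomComplex K Φ hq hfree
  asIso (ρ.descentHomComplex K Φ)

/-- The underlying chain map of `pullbackDescendComplexIso` is `descentHomComplex` (definitional). [cite: MumfordAV1970, §12 Thm. 1 (p. 112)] -/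
theorem pullbackDescendComplexIso_hom [IsAffineHom p] (hq : ρ.IsGeometricQuotient p)
    (hfree : ∀ (V : Q.Opens), IsAffineOpen V → ∀ g : G, g ≠ 1 →
      Ideal.span (Set.range fun b : Γ(X, p ⁻¹ᵁ V) ↦ ρ.act g V b - b) = ⊤)
    [∀ i, (K.X i).IsQuasicoherent] :
    (ρ.pullbackDescendComplexIso K Φ hq hfree).hom = ρ.descentHomComplex K Φ := rfl

end Complex

/-! ### §3 What descends with the complex: quasi-coherence, vanishing, local freeness, boundedness -/

section Properties

variable [Fintype G] (E : X.Modules) (φ : ∀ g : G, (Scheme.Modules.pullback (ρ.aut g).hom).obj E ≅ E)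

/-- `(p_* E)^G` is quasi-coherent for `p` affine and `E` quasi-coherent. [cite: MumfordAV1970, §7 Thm. p. 66 (2)] -/
theorem isQuasicoherent_moduleInvariants [IsAffineHom p] [E.IsQuasicoherent] :
    (ρ.moduleInvariants E φ).IsQuasicoherent :=
  isQuasicoherent_of_isAffineLocalizing
    (ρ.isAffineLocalizing_moduleInvariants E φ (IsAffineLocalizing.of_isQuasicoherent E))

/-- `(p_* E)^G = 0` if `E = 0` (a subobject of `p_* 0 = 0`). [cite: MumfordAV1970, §7 Thm. p. 66 (2)] -/
theorem isZero_moduleInvariants (hE : IsZero E) : IsZero (ρ.moduleInvariants E φ) :=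
  haveI := ρ.mono_moduleInvariantsι E φ
  IsZero.of_mono (ρ.moduleInvariantsι E φ) ((Scheme.Modules.pushforward p).map_isZero hE)

/-- **A `G`-linearised vector bundle descends to a vector bundle**: for an affine geometric quotient by
a finite group acting freely on the affine charts, if `E` is finite locally free (of any, possibly
non-constant, rank) then so is `(p_* E)^G`. On an affine `V ∋ q`: `p⁻¹V` is affine, `Γ(E, p⁻¹V)` is
finite projective (Görtz–Wedhorn I Cor. 7.42), hence `Γ((p_* E)^G, V)` is finite projective over
`Γ(Q, V)` (`finite_projective_sections_moduleInvariants`), which frames `(p_* E)^G` on a basic open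
`D(s) ∋ q`. The finite-group case of SGA 1 VIII Prop. 1.10 («localement libre de type fini» descends).
[cite: SGA1, Exp. VIII Prop. 1.10] [cite: GortzWedhorn2020, Cor. 7.42] -/
theorem isFiniteLocallyFree_moduleInvariants_of_free [IsAffineHom p] (hq : ρ.IsGeometricQuotient p)
    (hfree : ∀ (V : Q.Opens), IsAffineOpen V → ∀ g : G, g ≠ 1 →
      Ideal.span (Set.range fun b : Γ(X, p ⁻¹ᵁ V) ↦ ρ.act g V b - b) = ⊤)
    (hunit : (φ 1).hom = ((Scheme.Modules.pullbackCongr ρ.aut_one_hom).app E).hom ≫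
      ((Scheme.Modules.pullbackId X).app E).hom)
    (hcocycle : ∀ g h : G, (φ (g * h)).hom =
      ((Scheme.Modules.pullbackCongr (ρ.aut_mul_hom g h)).app E).hom ≫
        ((Scheme.Modules.pullbackComp (ρ.aut h).hom (ρ.aut g).hom).app E).inv ≫
          (Scheme.Modules.pullback (ρ.aut h).hom).map (φ g).hom ≫ (φ h).hom)
    (hE : IsFiniteLocallyFree E) : IsFiniteLocallyFree (ρ.moduleInvariants E φ) := by
  classical
  intro q
  haveI := hE.isVectorBundle.1
  have hEal : IsAffineLocalizing E := IsAffineLocalizing.of_isQuasicoherent E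
  have hFal : IsAffineLocalizing (ρ.moduleInvariants E φ) := ρ.isAffineLocalizing_moduleInvariants E φ hEal
  obtain ⟨V, hV, hqV, -⟩ := exists_isAffineOpen_mem_and_subset (U := ⊤) (Opens.mem_top q)
  obtain ⟨hfin, hproj⟩ := finite_projective_sections_of_isFiniteLocallyFree hE (hV.preimage p)
  obtain ⟨hFfin, hFproj⟩ := ρ.finite_projective_sections_moduleInvariants E φ hq (hfree V hV) hunit hcocycle
  obtain ⟨s, hqs, ι, hι, e⟩ := exists_free_over_basicOpen_of_projective_sections hFal hV hqV
  exact ⟨Q.basicOpen s, hqs, ι, hι, e⟩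

/-- **A bounded complex of `G`-linearised vector bundles descends to a bounded complex of vector
bundles** (termwise `isFiniteLocallyFree_moduleInvariants_of_free` and `isZero_moduleInvariants`).
[cite: SGA1, Exp. VIII Prop. 1.10] [cite: MumfordAV1970, §12 Thm. 1 (p. 112)] -/
theorem isBoundedVBComplex_descendComplex [IsAffineHom p] (hq : ρ.IsGeometricQuotient p)
    (hfree : ∀ (V : Q.Opens), IsAffineOpen V → ∀ g : G, g ≠ 1 →
      Ideal.span (Set.range fun b : Γ(X, p ⁻¹ᵁ V) ↦ ρ.act g V b - b) = ⊤)
    (K : CochainComplex X.Modules ℤ) (Φ : ρ.EquivariantComplexStructure K) (hK : IsBoundedVBComplex K) :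
    IsBoundedVBComplex (ρ.descendComplex K Φ) := by
  obtain ⟨s, hs⟩ := hK.exists_finset
  exact ⟨fun i => ρ.isFiniteLocallyFree_moduleInvariants_of_free (K.X i) (Φ.term i).iso hq hfree
      (Φ.term i).iso_one_hom (Φ.term i).iso_mul_hom (hK.isFiniteLocallyFree i),
    ⟨s, fun i hi => ρ.isZero_moduleInvariants (K.X i) (Φ.term i).iso (hs i hi)⟩⟩

/-- The terms of the descended complex are quasi-coherent for termwise quasi-coherent `K` and affine `p`.
[cite: MumfordAV1970, §7 Thm. p. 66 (2)] -/
theorem isQuasicoherent_descendComplex_X [IsAffineHom p] {κ : Type*} {c : ComplexShape κ}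
    (K : HomologicalComplex X.Modules c) (Φ : ρ.EquivariantComplexStructure K) [∀ i, (K.X i).IsQuasicoherent]
    (i : κ) : ((ρ.descendComplex K Φ).X i).IsQuasicoherent :=
  ρ.isQuasicoherent_moduleInvariants (K.X i) (Φ.term i).iso

end Properties

end Literature.AlgebraicGeometry.RelativeSpec.ActionOver

end
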